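import Mathlib
import Literature.Computability.AlgebraicComplexity.ArithCircuitProofs
import Literature.Computability.AlgebraicComplexity.PermanentIrreducible
import Literature.Computability.AlgebraicComplexity.StandardFamiliesProofs
import Literature.Barriers.ValiantsHypothesis.MonotoneGapDecomposition

/-!
# Crux `DivisionGap.PerCofactorDegreeReduction` (stmt-ValiantsHypothesis-15046), line `Sketch` —
# stub `stub_additiveCreation`: the prime walk to an additive creation point

**Theorem (`stub_additiveCreation`).** Let `n ≥ 2` and let `g ∈ ℝ≥0[x_ij]` (`n × n` variables) be
nonzero with `per_n ∣ g` read over `ℝ` (after `MvPolynomial.map NNReal.toRealHom`).  Then there are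
`c₁, c₂ ∈ ℝ≥0[x]` and weights `w₁, w₂ ∈ ℝ≥0` with `L(c₁), L(c₂), L(w₁c₁ + w₂c₂) ≤ L(g)`
(`L = complexity`, least size of a fan-in-two circuit over the semiring `ℝ≥0`),
`w₁c₁ + w₂c₂ ≠ 0`, `deg (w₁c₁ + w₂c₂) ≤ deg g`, `per_n ∣ w₁c₁ + w₂c₂` over `ℝ`, but
`per_n ∤ c₁` and `per_n ∤ c₂` over `ℝ`: an ADDITIVE CREATION POINT of per-divisibility.

## Proof (the prime walk)

`per_n` is prime in `ℝ[x]` (`perPoly_irreducible` and `MvPolynomial` over a field is a UFD).  Take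
a minimal fan-in-two circuit `P` for `g` over `ℝ≥0` (`ArithCircuit.exists_computes_size_eq_complexity`).
Every operand value met inside `P` costs `≤ P.size = L(g)`: the prefix circuit `P.gates.take (j+1)`
with output `gate j` computes the value of gate `j` (`gateValues_take`); variables, constants and
junk references cost `0`.  The walk keeps the invariant "value `v ≠ 0` and `per_n ∣ v` over `ℝ`" and
is a strong induction on the gate index (`walk`, stated for an operand evaluated against the first
`w` gate values, so that a reference to gate `j` is live only for `j < w` and reads junk `0`
otherwise — no well-formedness is needed):
* a variable `X e` or a constant `C c ≠ 0` is never divisible (`deg per_n = n ≥ 2 > 1`, degrees are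
  additive over the domain `ℝ`: `MvPolynomial.totalDegree_le_of_dvd_of_isDomain`);
* at a product gate `v = a · b` (both factors `≠ 0`) primality gives a divisible factor, of degree
  `≤ deg v` (`MvPolynomial.totalDegree_mul_of_isDomain` over `ℝ≥0`); the empty product `1` is not
  divisible, a unary product is its operand;
* at a sum gate `v = w₁c₁ + w₂c₂` restricted to its nonzero terms: one term `w c` ⇒ `per ∣ c`
  (`C w` is a unit over `ℝ`) and `deg c = deg (w c)`, descend; two terms with `per ∣ c₁` (or
  `per ∣ c₂`) ⇒ descend into it (`supp cᵢ ⊆ supp v` over `ℝ≥0`, so `deg cᵢ ≤ deg v`); two terms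
  with `per ∤ c₁`, `per ∤ c₂` ⇒ STOP, this is the creation point (its value is the gate value,
  cost `≤ P.size`); the empty sum `0` violates the invariant.
The output operand of `P` starts the walk (`P.eval = g`).

Leans on the tree only: `ArithCircuit.exists_computes_size_eq_complexity`, `complexity_le_size`,
`complexity_X_holds`, `complexity_C_holds`, `gateValues_take`, `getD_gateValues`,
`getD_gateValues_eq_zero`, `getD_take_gateValues`, `support_subset_of_eq_add`,
`perPoly_irreducible`, `perPoly_ne_zero`, `totalDegree_perPoly_holds`; Mathlib.  No definitions.
-/

noncomputable section

-- `Summit.ValiantsHypothesis.ValiantsHypothesis.…` is the tree's mandated single-conjunct layout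
-- (Problem = Summit), so the duplicated namespace component is intended.
set_option linter.dupNamespace false

namespace Summit.ValiantsHypothesis.ValiantsHypothesis.Theorems.DivisionGap.PerCofactorDegreeReduction.AdditiveCreation

open MvPolynomial Literature.Computability.AlgebraicComplexity ArithCircuit
open Literature.Barriers.ValiantsHypothesis
open scoped NNReal BigOperators

/-! ### Algebra: `ℝ≥0[x] ↪ ℝ[x]`, primality and degree of `per_n` -/

/-- The coefficient extension `ℝ≥0[x] → ℝ[x]` is injective. [folklore] -/
theorem map_toRealHom_injective {σ : Type*} :
    Function.Injective
      (MvPolynomial.map NNReal.toRealHom : MvPolynomial σ ℝ≥0 → MvPolynomial σ ℝ) :=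
  map_injective _ NNReal.coe_injective

/-- A nonzero `p ∈ ℝ≥0[x]` stays nonzero in `ℝ[x]`. [folklore] -/
theorem map_toRealHom_ne_zero {σ : Type*} {p : MvPolynomial σ ℝ≥0} (hp : p ≠ 0) :
    MvPolynomial.map NNReal.toRealHom p ≠ 0 := fun h =>
  hp (map_toRealHom_injective (by rw [h, map_zero]))

/-- The generic permanent `per_n` (`n ≥ 1`) is prime in `ℝ[x_ij]`: it is irreducible
(von zur Gathen 1987, tree theorem `perPoly_irreducible`) in a UFD. [cite: Vonzurgathen1987, Thm. 3.4] -/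
theorem perPoly_prime {n : ℕ} (hn : 1 ≤ n) : Prime (perPoly (Fin n) ℝ) := by
  haveI : Nonempty (Fin n) := ⟨⟨0, hn⟩⟩
  exact UniqueFactorizationMonoid.irreducible_iff_prime.mp perPoly_irreducible

/-- A nonzero real multiple of `per_n` has total degree `≥ n` (degrees add over the domain `ℝ`,
`deg per_n = n`). [folklore] -/
theorem le_totalDegree_of_perPoly_dvd {n : ℕ} {v : MvPolynomial (Fin n × Fin n) ℝ} (hv : v ≠ 0)
    (hdvd : perPoly (Fin n) ℝ ∣ v) : n ≤ v.totalDegree := by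
  have h := totalDegree_le_of_dvd_of_isDomain hdvd hv
  rwa [totalDegree_perPoly_holds (n := Fin n) (k := ℝ), Fintype.card_fin] at h

/-- Over `ℝ≥0` a nonzero scalar does not lower the total degree. [folklore] -/
theorem totalDegree_le_totalDegree_smul {σ : Type*} {w : ℝ≥0} (hw : w ≠ 0)
    (c : MvPolynomial σ ℝ≥0) : c.totalDegree ≤ (w • c).totalDegree := by
  conv_lhs => rw [← inv_smul_smul₀ hw c]
  exact totalDegree_smul_le _ _

/-- Over `ℝ≥0` nothing cancels: `deg c₁ ≤ deg (w₁ c₁ + q)` for `w₁ ≠ 0`. [folklore] -/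
theorem totalDegree_le_totalDegree_smul_add {σ : Type*} {w₁ : ℝ≥0} (hw : w₁ ≠ 0)
    (c₁ q : MvPolynomial σ ℝ≥0) : c₁.totalDegree ≤ (w₁ • c₁ + q).totalDegree :=
  (totalDegree_le_totalDegree_smul hw c₁).trans
    (totalDegree_le_of_support_subset (support_subset_of_eq_add rfl))

/-- One step of the walk through a weighted term: if `w • c ≠ 0` and `per_n ∣ w • c` over `ℝ`, then
`c ≠ 0`, `per_n ∣ c` over `ℝ` (`C w` is a unit) and `deg c ≤ deg (w • c)`. [folklore] -/
theorem descend_smul {n : ℕ} {w : ℝ≥0} {c : MvPolynomial (Fin n × Fin n) ℝ≥0} (hne : w • c ≠ 0)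
    (hdvd : perPoly (Fin n) ℝ ∣ MvPolynomial.map NNReal.toRealHom (w • c)) :
    c ≠ 0 ∧ perPoly (Fin n) ℝ ∣ MvPolynomial.map NNReal.toRealHom c ∧
      c.totalDegree ≤ (w • c).totalDegree := by
  have hw : w ≠ 0 := by
    rintro rfl
    exact hne (zero_smul _ _)
  have hc : c ≠ 0 := by
    rintro rfl
    exact hne (smul_zero _)
  refine ⟨hc, ?_, totalDegree_le_totalDegree_smul hw c⟩
  have hu : IsUnit (C (NNReal.toRealHom w) : MvPolynomial (Fin n × Fin n) ℝ) :=
    (IsUnit.mk0 _ (by simpa using hw)).map C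
  rw [smul_eq_C_mul, map_mul, map_C] at hdvd
  exact hu.dvd_mul_left.mp hdvd

/-! ### Circuits: every operand value of a fan-in-two circuit costs at most its size -/

section Cost

variable {k : Type*} [CommSemiring k] {σ : Type*}

/-- The value of gate `j` of a fan-in-two circuit `P` is computed by the prefix circuit
`P.gates.take (j+1)` with output `gate j`, hence costs `≤ P.size` (Bürgisser 2000, Def. 2.1).
[cite: Burgisser2000, Def. 2.1] -/
theorem complexity_getD_gateValues_le (P : ArithCircuit k σ) (h2 : P.IsFanInTwo) (j : ℕ) :
    complexity ((gateValues P.gates).getD j 0) ≤ P.size := by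
  let Q : ArithCircuit k σ := ⟨P.gates.take (j + 1), .gate j⟩
  have hQ2 : Q.IsFanInTwo := fun g hg => h2 g (List.mem_of_mem_take hg)
  have hQc : Q.Computes ((gateValues P.gates).getD j 0) := by
    change (Operand.gate j : Operand k σ).eval (gateValues (P.gates.take (j + 1))) = _
    rw [Operand.eval_gate, ← gateValues_take, List.getD_eq_getElem?_getD,
      List.getD_eq_getElem?_getD, List.getElem?_take, if_pos (Nat.lt_succ_self j)]
  calc complexity ((gateValues P.gates).getD j 0) ≤ Q.size := complexity_le_size hQ2 hQc
    _ ≤ P.size := by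
      simp only [size, Q, List.length_take]
      exact Nat.min_le_right _ _

/-- Every operand of a fan-in-two circuit `P`, evaluated against the first `w` gate values, costs
`≤ P.size`: variables and constants are free, live references are gate values, junk references
read `0 = C 0` (Bürgisser 2000, Def. 2.1). [cite: Burgisser2000, Def. 2.1] -/
theorem complexity_eval_take_le (P : ArithCircuit k σ) (h2 : P.IsFanInTwo) (w : ℕ)
    (u : Operand k σ) : complexity (u.eval ((gateValues P.gates).take w)) ≤ P.size := by
  cases u with
  | var i => exact (complexity_X_holds (k := k) (σ := σ) i).trans_le (Nat.zero_le _)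
  | const c => exact (complexity_C_holds (σ := σ) c).trans_le (Nat.zero_le _)
  | gate j =>
    rw [Operand.eval_gate, getD_take_gateValues]
    split_ifs
    · exact complexity_getD_gateValues_le P h2 j
    · have h0 : complexity (0 : MvPolynomial σ k) = 0 := by
        simpa using complexity_C_holds (σ := σ) (0 : k)
      exact h0.trans_le (Nat.zero_le _)

end Cost

/-! ### The walk -/

/-- **The prime walk** (strong induction on the horizon `w`).  In a fan-in-two circuit `P` over
`ℝ≥0` (`n ≥ 2`), if an operand evaluated against the first `w` gate values has a nonzero value `v`
with `per_n ∣ v` over `ℝ` and `deg v ≤ d`, then below it there is an additive creation point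
`w₁c₁ + w₂c₂` (a sum-gate value with both terms nonzero) with `per_n ∣ w₁c₁ + w₂c₂`,
`per_n ∤ c₁`, `per_n ∤ c₂` over `ℝ`, all of cost `≤ P.size` and `deg (w₁c₁ + w₂c₂) ≤ d`.
[folklore] -/
theorem walk {n : ℕ} (hn : 2 ≤ n) (P : ArithCircuit ℝ≥0 (Fin n × Fin n)) (h2 : P.IsFanInTwo)
    (w : ℕ) :
    ∀ (u : Operand ℝ≥0 (Fin n × Fin n)) (d : ℕ),
      u.eval ((gateValues P.gates).take w) ≠ 0 →
      perPoly (Fin n) ℝ ∣ MvPolynomial.map NNReal.toRealHom (u.eval ((gateValues P.gates).take w)) →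
      (u.eval ((gateValues P.gates).take w)).totalDegree ≤ d →
      ∃ (c₁ c₂ : MvPolynomial (Fin n × Fin n) ℝ≥0) (w₁ w₂ : ℝ≥0),
        complexity c₁ ≤ P.size ∧ complexity c₂ ≤ P.size ∧
        complexity (w₁ • c₁ + w₂ • c₂) ≤ P.size ∧
        w₁ • c₁ + w₂ • c₂ ≠ 0 ∧ (w₁ • c₁ + w₂ • c₂).totalDegree ≤ d ∧
        perPoly (Fin n) ℝ ∣ MvPolynomial.map NNReal.toRealHom (w₁ • c₁ + w₂ • c₂) ∧
        ¬ perPoly (Fin n) ℝ ∣ MvPolynomial.map NNReal.toRealHom c₁ ∧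
        ¬ perPoly (Fin n) ℝ ∣ MvPolynomial.map NNReal.toRealHom c₂ := by
  have hprime : Prime (perPoly (Fin n) ℝ) := perPoly_prime (by omega)
  induction w using Nat.strong_induction_on with
  | _ w ih =>
    intro u d hne hdvd hdeg
    cases u with
    | var e =>
      exfalso
      have h := le_totalDegree_of_perPoly_dvd (map_toRealHom_ne_zero hne) hdvd
      simp only [Operand.eval, map_X, totalDegree_X] at h
      omega
    | const c =>
      exfalso
      have h := le_totalDegree_of_perPoly_dvd (map_toRealHom_ne_zero hne) hdvd
      simp only [Operand.eval, map_C, totalDegree_C] at h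
      omega
    | gate j =>
      simp only [Operand.eval_gate, getD_take_gateValues] at hne hdvd hdeg ⊢
      by_cases hjw : j < w
      · simp only [hjw, if_true] at hne hdvd hdeg ⊢
        -- the gate at `j` exists (junk values are `0`)
        rcases hg : P.gates[j]? with _ | g
        · exact absurd (getD_gateValues_eq_zero hg) hne
        have hval := getD_gateValues hg
        have hcostv : complexity (g.eval ((gateValues P.gates).take j)) ≤ P.size :=
          hval ▸ complexity_getD_gateValues_le P h2 j
        rw [hval] at hne hdvd hdeg
        have hop := ih j hjw
        set vs := (gateValues P.gates).take j
        have hcost : ∀ u : Operand ℝ≥0 (Fin n × Fin n), complexity (u.eval vs) ≤ P.size :=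
          fun u => complexity_eval_take_le P h2 j u
        have hfan : g.fanIn ≤ 2 := h2 g (List.mem_of_getElem? hg)
        cases g with
        | sum args =>
          rcases args with _ | ⟨a, _ | ⟨b, _ | ⟨c, rest⟩⟩⟩
          · -- empty sum `= 0`
            simp [Gate.eval] at hne
          · -- one term `a.1 • a.2`
            simp only [Gate.eval, List.map_cons, List.map_nil, List.sum_cons, List.sum_nil,
              add_zero] at hne hdvd hdeg
            obtain ⟨hc, hcd, hcdeg⟩ := descend_smul hne hdvd
            exact hop a.2 d hc hcd (hcdeg.trans hdeg)
          · -- two terms `a.1 • a.2 + b.1 • b.2`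
            simp only [Gate.eval, List.map_cons, List.map_nil, List.sum_cons, List.sum_nil,
              add_zero] at hne hdvd hdeg hcostv ⊢
            by_cases ha : a.1 • a.2.eval vs = 0
            · rw [ha, zero_add] at hne hdvd hdeg
              obtain ⟨hc, hcd, hcdeg⟩ := descend_smul hne hdvd
              exact hop b.2 d hc hcd (hcdeg.trans hdeg)
            by_cases hb : b.1 • b.2.eval vs = 0
            · rw [hb, add_zero] at hne hdvd hdeg
              obtain ⟨hc, hcd, hcdeg⟩ := descend_smul hne hdvd
              exact hop a.2 d hc hcd (hcdeg.trans hdeg)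
            -- both terms are nonzero
            have ha1 : a.1 ≠ 0 := fun h => ha (by rw [h, zero_smul])
            have ha2 : a.2.eval vs ≠ 0 := fun h => ha (by rw [h, smul_zero])
            have hb1 : b.1 ≠ 0 := fun h => hb (by rw [h, zero_smul])
            have hb2 : b.2.eval vs ≠ 0 := fun h => hb (by rw [h, smul_zero])
            by_cases h₁ : perPoly (Fin n) ℝ ∣ MvPolynomial.map NNReal.toRealHom (a.2.eval vs)
            · exact hop a.2 d ha2 h₁
                ((totalDegree_le_totalDegree_smul_add ha1 _ _).trans hdeg)
            by_cases h₂ : perPoly (Fin n) ℝ ∣ MvPolynomial.map NNReal.toRealHom (b.2.eval vs)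
            · refine hop b.2 d hb2 h₂ (le_trans ?_ hdeg)
              rw [add_comm]
              exact totalDegree_le_totalDegree_smul_add hb1 _ _
            -- the additive creation point
            exact ⟨a.2.eval vs, b.2.eval vs, a.1, b.1, hcost a.2, hcost b.2, hcostv, hne, hdeg,
              hdvd, h₁, h₂⟩
          · -- fan-in `≥ 3` is excluded
            simp [Gate.fanIn, Gate.args] at hfan
        | prod args =>
          rcases args with _ | ⟨u₁, _ | ⟨u₂, _ | ⟨u₃, rest⟩⟩⟩
          · -- empty product `= 1`
            exfalso
            simp only [Gate.eval, List.map_nil, List.prod_nil] at hdvd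
            have h := le_totalDegree_of_perPoly_dvd (map_toRealHom_ne_zero one_ne_zero) hdvd
            simp only [map_one, totalDegree_one] at h
            omega
          · -- unary product: its operand
            simp only [Gate.eval, List.map_cons, List.map_nil, List.prod_cons, List.prod_nil,
              mul_one] at hne hdvd hdeg
            exact hop u₁ d hne hdvd hdeg
          · -- binary product: a prime divides a factor
            simp only [Gate.eval, List.map_cons, List.map_nil, List.prod_cons, List.prod_nil,
              mul_one] at hne hdvd hdeg
            have hne₁ : u₁.eval vs ≠ 0 := left_ne_zero_of_mul hne
            have hne₂ : u₂.eval vs ≠ 0 := right_ne_zero_of_mul hne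
            have hdeg12 := totalDegree_mul_of_isDomain hne₁ hne₂
            rw [map_mul] at hdvd
            rcases hprime.dvd_or_dvd hdvd with hd | hd
            · exact hop u₁ d hne₁ hd (by omega)
            · exact hop u₂ d hne₂ hd (by omega)
          · -- fan-in `≥ 3` is excluded
            simp [Gate.fanIn, Gate.args] at hfan
      · simp only [hjw, if_false] at hne
        exact absurd rfl hne

/-! ### The stub -/

/-- **stub_additiveCreation — the PRIME WALK to an additive creation point.**  For `n ≥ 2` and a
nonzero `g ≥ 0` with `per_n ∣ g` over `ℝ`: inside a minimal fan-in-two circuit for `g` over `ℝ≥0`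
(`ArithCircuit.exists_computes_size_eq_complexity`) per-divisibility descends from the output
through product gates (primality of `per_n` in `ℝ[x]`) and through sum gates with a divisible
nonzero term, and stops at a sum gate `w₁c₁ + w₂c₂ ∈ (per_n)` with `c₁, c₂ ∉ (per_n)`; every value
met is an operand value of the circuit (cost `≤ L(g)`) and degrees only drop (no cancellation over
`ℝ≥0`).  See `walk`. [folklore] -/
theorem stub_additiveCreation (n : ℕ) (hn : 2 ≤ n) (g : MvPolynomial (Fin n × Fin n) ℝ≥0)
    (hg : g ≠ 0) (hdvd : perPoly (Fin n) ℝ ∣ MvPolynomial.map NNReal.toRealHom g) :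
    ∃ (c₁ c₂ : MvPolynomial (Fin n × Fin n) ℝ≥0) (w₁ w₂ : ℝ≥0),
      complexity c₁ ≤ complexity g ∧ complexity c₂ ≤ complexity g ∧
      complexity (w₁ • c₁ + w₂ • c₂) ≤ complexity g ∧
      w₁ • c₁ + w₂ • c₂ ≠ 0 ∧ (w₁ • c₁ + w₂ • c₂).totalDegree ≤ g.totalDegree ∧
      perPoly (Fin n) ℝ ∣ MvPolynomial.map NNReal.toRealHom (w₁ • c₁ + w₂ • c₂) ∧
      ¬ perPoly (Fin n) ℝ ∣ MvPolynomial.map NNReal.toRealHom c₁ ∧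
      ¬ perPoly (Fin n) ℝ ∣ MvPolynomial.map NNReal.toRealHom c₂ := by
  obtain ⟨P, h2, hP, hsize⟩ := exists_computes_size_eq_complexity g
  have heval : P.output.eval ((gateValues P.gates).take P.size) = g := by
    rw [List.take_of_length_le (by rw [gateValues_length]; rfl)]
    exact hP
  have hdeg : (P.output.eval ((gateValues P.gates).take P.size)).totalDegree ≤ g.totalDegree := by
    rw [heval]
  rw [← heval] at hg hdvd
  obtain ⟨c₁, c₂, w₁, w₂, h⟩ := walk hn P h2 P.size P.output g.totalDegree hg hdvd hdeg
  rw [hsize] at h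
  exact ⟨c₁, c₂, w₁, w₂, h⟩

end Summit.ValiantsHypothesis.ValiantsHypothesis.Theorems.DivisionGap.PerCofactorDegreeReduction.AdditiveCreation

end
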